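import Literature.AlgebraicTopology.SingularHomology.LoopClassesSpan
import Literature.Topology.FourManifolds.TautFoliationsNovikov
import Summits.SmoothPoincare4.SmoothPoincare4.Theorems.SblfDescentRungOneHelperDegreeLift
import HarnessLib

/-!
# The winding functional of a circle-valued map on first homology

Helper layer `helper_degree_winding` of the brick `helper_sliceGluing_vanishingDegree` (apex
leaf F0, the degree lemma; homological core `helper_degree_core`) of line `Sketch`, crux
`SblfDescent.RungOne` (crux item stmt-SmoothPoincare4-18531).

For a continuous `g : Y → 𝕊¹ ⊆ ℝ²` the **winding functional**
`W_g : H₁(Y; ℤ) → ℂ` is `windH ∘ (ι ∘ g)_*`, where `ι : 𝕊¹ ↪ ℂ ∖ 0`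
(`Foliation.circleToCStar`) and `windH : H₁(ℂ ∖ 0; ℤ) → ℂ` is the de Rham pairing with `dz/z`
(`HurewiczOne.lean`).  We record the calculus used by the homological core of the degree lemma:

* `helper_degree_winding_loopClass` — on the Hurewicz class of a loop `γ`, `W_g [γ] = 2πi k`
  where `k = L 1 - L 0` for any continuous lift `g ∘ γ = circlePt ∘ L` (so `k` is the degree of
  the loop `g ∘ γ`), and `helper_degree_winding_exists_lift` — such lifts exist;
* `helper_degree_winding_comp` — naturality `W_{g ∘ h} = W_g ∘ h_*`;
* `helper_degree_winding_mem` — on a path-connected space `W_g` takes values in `2πi ℤ`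
  (loop classes span `H₁`, `LoopClassesSpan.lean`);
* `helper_degree_winding_eq_zero_of_lift` — if `g` factors continuously through
  `circlePt : ℝ → 𝕊¹` then `W_g = 0`;
* `helper_degree_winding` (registered) — the package used by the core: two winding functionals
  on a path-connected space agree as soon as the corresponding loops have lifts with equal
  increments.

## References

* A. Hatcher, *Algebraic Topology* (2002), Thm. 1.7, §2.A Thm. 2A.1. [HatcherAT2002]
-/

set_option linter.dupNamespace false

noncomputable section

open scoped Manifold Topology unitInterval
open Set Function Literature.Topology.FourManifolds Literature.AlgebraicTopology.SingularHomology
open Literature.AlgebraicTopology.FundamentalGroup.PuncturedPlane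

namespace Summit.SmoothPoincare4.SmoothPoincare4.Cruxes.RungOne.Sketch

variable {Y Z : Type} [TopologicalSpace Y] [TopologicalSpace Z]

/-- **The winding functional** `W_g = windH ∘ (ι ∘ g)_* : H₁(Y; ℤ) → ℂ` of a continuous
circle-valued map `g : Y → 𝕊¹` (`ι : 𝕊¹ ↪ ℂ ∖ 0`). [cite: HatcherAT2002, Thm. 2A.1] -/
def helper_degree_windingFunctional (g : C(Y, Metric.sphere (0 : EuclideanSpace ℝ (Fin 2)) 1)) :
    singularHomology ℤ ℤ Y 1 →ₗ[ℤ] ℂ :=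
  windH ∘ₗ (singularHomology.map ℤ ℤ (Foliation.circleToCStar.comp g) 1).hom

/-- The inclusion `𝕊¹ ↪ ℂ ∖ 0` on `circlePt s` is `e^{2πis}`. [folklore] -/
theorem helper_degree_circleToCStar_circlePt (s : ℝ) :
    ((Foliation.circleToCStar (circlePt s) : CStar) : ℂ) = Complex.exp (2 * Real.pi * s * Complex.I) := by
  rw [Foliation.circleToCStar_apply_coe, ← toC_eq_orthonormalBasisOneI_repr_symm, toC_circlePt,
    Circle.coe_exp]
  congr 1
  push_cast
  ring

/-- **The winding functional on a loop class**: if `g ∘ γ = circlePt ∘ L` on `[0, 1]` for a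
continuous `L`, then `W_g [γ] = 2πi (L 1 - L 0)`. [cite: HatcherAT2002, Thm. 1.7, Thm. 2A.1] -/
theorem helper_degree_winding_loopClass (g : C(Y, Metric.sphere (0 : EuclideanSpace ℝ (Fin 2)) 1))
    {y₀ : Y} (γ : Path y₀ y₀) {L : ℝ → ℝ} (hL : Continuous L)
    (hlift : ∀ t : I, g (γ t) = circlePt (L t)) :
    helper_degree_windingFunctional g (loopClass ℤ ℤ (1 : ℤ) γ) =
      ((L 1 - L 0 : ℝ) : ℂ) * (2 * Real.pi * Complex.I) := by
  rw [helper_degree_windingFunctional, LinearMap.comp_apply]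
  change windH (singularHomology.map ℤ ℤ (Foliation.circleToCStar.comp g) 1 (loopClass ℤ ℤ (1 : ℤ) γ)) = _
  rw [map_loopClass, windH_loopClass,
    edgeLog_eq (l := fun t : ℝ => 2 * Real.pi * L t * Complex.I) (by fun_prop) fun t ht => ?_]
  · push_cast; ring
  · rw [edgeFun_ofPath _ ht]
    change Complex.exp (2 * Real.pi * L t * Complex.I) =
      ((Foliation.circleToCStar (g (γ ⟨t, ht⟩)) : CStar) : ℂ)
    rw [hlift ⟨t, ht⟩, helper_degree_circleToCStar_circlePt]

/-- **Lifts along loops exist**: `g ∘ γ = circlePt ∘ L` on `[0, 1]` for some continuous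
`L : ℝ → ℝ`. [cite: HatcherAT2002, Prop. 1.30] -/
theorem helper_degree_winding_exists_lift (g : C(Y, Metric.sphere (0 : EuclideanSpace ℝ (Fin 2)) 1))
    {y₀ : Y} (γ : Path y₀ y₀) :
    ∃ L : ℝ → ℝ, Continuous L ∧ ∀ t : I, g (γ t) = circlePt (L t) := by
  have hc : Continuous fun s : ℝ => g (γ (projIcc 0 1 zero_le_one s)) :=
    g.continuous.comp (γ.continuous.comp continuous_projIcc)
  obtain ⟨L, hL, hLl⟩ := helper_degree_exists_lift (A := ℝ) hc
  exact ⟨L, hL, fun t => by rw [← hLl t, projIcc_val]⟩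

/-- The increment of a lift along a loop is an integer. [cite: HatcherAT2002, Thm. 1.7] -/
theorem helper_degree_winding_increment_int (g : C(Y, Metric.sphere (0 : EuclideanSpace ℝ (Fin 2)) 1))
    {y₀ : Y} (γ : Path y₀ y₀) {L : ℝ → ℝ} (hlift : ∀ t : I, g (γ t) = circlePt (L t)) :
    ∃ k : ℤ, L 1 - L 0 = k := by
  have h : circlePt (L 1) = circlePt (L 0) := by
    have h1 := hlift 1
    have h0 := hlift 0
    simp only [Set.Icc.coe_one, Set.Icc.coe_zero, Path.target, Path.source] at h1 h0
    rw [← h1, ← h0]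
  obtain ⟨k, hk⟩ := circlePt_eq_circlePt_iff.1 h
  exact ⟨k, by rw [hk]; ring⟩

/-- **Naturality of the winding functional**: `W_{g ∘ h} = W_g ∘ h_*`. [folklore] -/
theorem helper_degree_winding_comp (g : C(Y, Metric.sphere (0 : EuclideanSpace ℝ (Fin 2)) 1))
    (h : C(Z, Y)) :
    helper_degree_windingFunctional (g.comp h) =
      helper_degree_windingFunctional g ∘ₗ (singularHomology.map ℤ ℤ h 1).hom := by
  rw [helper_degree_windingFunctional, helper_degree_windingFunctional, LinearMap.comp_assoc]
  congr 1
  rw [← ContinuousMap.comp_assoc, singularHomology.map_comp]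
  rfl

/-- **The winding functional takes values in `2πi ℤ`** on a path-connected space (loop classes
span `H₁`; on a loop class the value is `2πi` times the degree of `g ∘ γ`).
[cite: HatcherAT2002, Thm. 2A.1] -/
theorem helper_degree_winding_mem [PathConnectedSpace Y]
    (g : C(Y, Metric.sphere (0 : EuclideanSpace ℝ (Fin 2)) 1)) (x : singularHomology ℤ ℤ Y 1) :
    ∃ n : ℤ, helper_degree_windingFunctional g x = n * (2 * Real.pi * Complex.I) := by
  obtain ⟨y₀⟩ := (inferInstance : Nonempty Y)
  -- the functional vanishes modulo the lattice `2πi ℤ`: a linear-map identity, checked on loop classes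
  set S : Submodule ℤ ℂ := Submodule.span ℤ {(2 * Real.pi * Complex.I : ℂ)} with hS
  have hq : S.mkQ ∘ₗ helper_degree_windingFunctional g = 0 := by
    refine singularHomology.linearMap_ext_loopClass y₀ fun γ => ?_
    obtain ⟨L, hL, hLl⟩ := helper_degree_winding_exists_lift g γ
    obtain ⟨k, hk⟩ := helper_degree_winding_increment_int g γ hLl
    rw [LinearMap.zero_apply, LinearMap.comp_apply, helper_degree_winding_loopClass g γ hL hLl, hk,
      Submodule.mkQ_apply, Submodule.Quotient.mk_eq_zero, hS]
    refine Submodule.mem_span_singleton.2 ⟨k, ?_⟩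
    rw [zsmul_eq_mul]; push_cast; rfl
  have hx : S.mkQ (helper_degree_windingFunctional g x) = 0 := by
    have := congrArg (fun φ => φ x) hq
    simpa using this
  rw [Submodule.mkQ_apply, Submodule.Quotient.mk_eq_zero, hS, Submodule.mem_span_singleton] at hx
  obtain ⟨n, hn⟩ := hx
  exact ⟨n, by rw [← hn, zsmul_eq_mul]⟩

/-- **A circle-valued map with a continuous real lift has zero winding functional** (on a
path-connected space). [folklore] -/
theorem helper_degree_winding_eq_zero_of_lift [PathConnectedSpace Y]
    (g : C(Y, Metric.sphere (0 : EuclideanSpace ℝ (Fin 2)) 1)) (Λ : Y → ℝ) (hΛ : Continuous Λ)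
    (hg : ∀ y, g y = circlePt (Λ y)) : helper_degree_windingFunctional g = 0 := by
  obtain ⟨y₀⟩ := (inferInstance : Nonempty Y)
  refine singularHomology.linearMap_ext_loopClass y₀ fun γ => ?_
  rw [LinearMap.zero_apply, helper_degree_winding_loopClass g γ (L := fun s => Λ (γ (projIcc 0 1 zero_le_one s)))
    (hΛ.comp (γ.continuous.comp continuous_projIcc)) fun t => by simp [hg]]
  simp only [Set.Icc.mk_one, Set.Icc.mk_zero, projIcc_right, projIcc_left, Path.target, Path.source,
    sub_self, Complex.ofReal_zero, zero_mul]

/-- **Comparison of winding functionals by lifts along loops** (registered layer of the degree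
lemma): on a path-connected space with base point `y₀`, if for every loop `γ` at `y₀` the maps
`g₁ ∘ γ`, `g₂ ∘ γ`, `g₃ ∘ γ` admit continuous lifts whose increments satisfy
`k₁ = k₂ + w k₃`, then `W_{g₁} = W_{g₂} + w W_{g₃}` on `H₁(Y; ℤ)`. [cite: HatcherAT2002, Thm. 2A.1] -/
theorem helper_degree_winding : ∀ (Y : Type) [TopologicalSpace Y] [PathConnectedSpace Y] (y₀ : Y) (g₁ g₂ g₃ : C(Y, Metric.sphere (0 : EuclideanSpace ℝ (Fin 2)) 1)) (w : ℤ), (∀ γ : Path y₀ y₀, ∃ L₁ L₂ L₃ : ℝ → ℝ, Continuous L₁ ∧ Continuous L₂ ∧ Continuous L₃ ∧ (∀ t : unitInterval, g₁ (γ t) = circlePt (L₁ t)) ∧ (∀ t : unitInterval, g₂ (γ t) = circlePt (L₂ t)) ∧ (∀ t : unitInterval, g₃ (γ t) = circlePt (L₃ t)) ∧ L₁ 1 - L₁ 0 = (L₂ 1 - L₂ 0) + w * (L₃ 1 - L₃ 0)) → helper_degree_windingFunctional g₁ = helper_degree_windingFunctional g₂ + w • helper_degree_windingFunctional g₃ :=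 by
  intro Y _ _ y₀ g₁ g₂ g₃ w h
  refine singularHomology.linearMap_ext_loopClass y₀ fun γ => ?_
  obtain ⟨L₁, L₂, L₃, hL₁, hL₂, hL₃, h₁, h₂, h₃, hk⟩ := h γ
  rw [LinearMap.add_apply, LinearMap.smul_apply, helper_degree_winding_loopClass g₁ γ hL₁ h₁,
    helper_degree_winding_loopClass g₂ γ hL₂ h₂, helper_degree_winding_loopClass g₃ γ hL₃ h₃, hk,
    zsmul_eq_mul]
  push_cast
  ring

end Summit.SmoothPoincare4.SmoothPoincare4.Cruxes.RungOne.Sketch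

end
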